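import Mathlib
import HarnessLib
import Literature.MathematicalPhysics.QuantumFieldTheory.ConstructiveQFTWave0
import Summits.Ventures.LatticeQCDFlow.Scaling.LatticeEntropy

/-!
# LatticeQCDFlow / Scaling — the Gibbs identity for the Wilson measure, PROVED
(THEORY-2.md §3.2 v2.0 (a) in measure form, §4 T2-AH, R-T2-10)

HONEST FRAMING: exact (Metropolis-corrected) sampling algorithms for lattice gauge theory;
figures of merit are autocorrelation/cost numbers at stated couplings and volumes; no
continuum-physics claim.

`theorem gibbsIdentity (d : ℕ) : GibbsIdentity d` — for the Wilson measure
`μ_{Λ,β} = Z⁻¹·exp(−β S)·Haar^{⊗E}` of ANY continuous representation with `Re tr ρ ≤ N` of ANY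
compact second-countable group on the torus `(ℤ/L)^d`, `β ≥ 0`:
`D(μ_{Λ,β} ‖ Haar^{⊗E}) = −β·⟨S⟩_{Λ,β} − log Z_Λ(β)` (Mathlib's `InformationTheory.klDiv`, the
tree's `wilsonExpectation` and `partitionFunction`).  This is the bridge between the finite
entropy budget (`Scaling/EntropyBudget.lean`, `Scaling/FreeEnergyBudget.lean`: `klFin_tiltLaw`) and
the actual lattice measure: the TARGET SIDE of the budget `D(p‖η) + log ESS ≤ log M + E log J` is a
free energy, bounded from both sides by `Scaling/LatticePeeling.lean: peelingBound` (upper bound on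
`Z`) and `Scaling/LatticeEntropy.lean: smallBallBound` (lower bound on `Z`).

Proof (≈ 100 lines): `Z ≠ 0` (the density is everywhere positive, `lintegral_pos_iff_support`),
`Z ≠ ⊤` (`partitionFunction_le_one`), so `μ` is a probability measure and `μ ≪ π`;
`dμ/dπ = Z⁻¹·exp(−β S)` `π`-a.e. (`Measure.rnDeriv_smul_left_of_ne_top'`,
`Measure.rnDeriv_withDensity` — measurability of the density from `Continuous ρ` and
`SecondCountableTopology G`), hence `llr μ π = log Z⁻¹ − β S` `μ`-a.e.; `S` is continuous on the
compact configuration space, hence bounded and integrable (`Integrable.of_bound`); conclude with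
`InformationTheory.toReal_klDiv`.  Axioms: propext, Classical.choice, Quot.sound.

Second half (TWO FREE ENERGIES, measure form of `Theory2.klFin_tiltLaw_ge`): Jensen for `exp`
against the Wilson probability measure (`ConvexOn.map_integral_le`) gives
`(β − β₁)·⟨S⟩_{Λ,β} ≤ log Z_Λ(β₁) − log Z_Λ(β)` (`mean_action_le_wilson`), hence with the Gibbs
identity `β₁·log Z_Λ(β) − β·log Z_Λ(β₁) ≤ (β − β₁)·D(μ_{Λ,β} ‖ Haar^{⊗E})` for `β, β₁ ≥ 0`
(`twoFreeEnergies_wilson`; typed item `TwoFreeEnergies`, discharged by `twoFreeEnergies`).  This is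
the entropy LOWER bound from two values of the free energy used by
`Scaling/LatticeEntropyGrowth.lean`.
-/

namespace Summit.Ventures.LatticeQCDFlow.Theory2.Lattice

open MeasureTheory Literature.MathematicalPhysics.QuantumFieldTheory

/-! ## Gibbs identity (T2-AH, GibbsIdentity): `D(μ_{Λ,β} ‖ Haar^{⊗E}) = −β⟨S⟩_β − log Z_Λ(β)` -/

section Gibbs

variable {N : ℕ} {G : Type*} [Group G] [TopologicalSpace G] [IsTopologicalGroup G]
  [CompactSpace G] [SecondCountableTopology G] [MeasurableSpace G] [BorelSpace G]
  (ρ : G →* Matrix (Fin N) (Fin N) ℂ)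

omit [CompactSpace G] [SecondCountableTopology G] [MeasurableSpace G] [BorelSpace G] in
/-- The Wilson action is continuous in the configuration (continuous `ρ`). [folklore] -/
theorem continuous_wilsonAction {d L : ℕ} [NeZero L]
    (hρ : Continuous (ρ : G → Matrix (Fin N) (Fin N) ℂ)) :
    Continuous (wilsonAction (d := d) (L := L) (G := G) ρ) := by
  unfold wilsonAction
  refine continuous_finsetSum _ fun p _ => ?_
  have h1 : Continuous fun U : GaugeConfig d L G => plaquetteHolonomy U p.1 p.2.1.1 p.2.1.2 := by
    unfold plaquetteHolonomy; fun_prop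
  have h2 : Continuous fun U : GaugeConfig d L G =>
      (ρ (plaquetteHolonomy U p.1 p.2.1.1 p.2.1.2)).trace.re :=
    Complex.continuous_re.comp (hρ.comp h1).matrix_trace
  have h0 : Continuous fun t : ℝ => (N : ℝ) - t := by fun_prop
  exact h0.comp h2

omit [CompactSpace G] in
/-- The Wilson density `exp(−β S)` is measurable for the product σ-algebra. [folklore] -/
theorem measurable_wilsonDensity {d L : ℕ} [NeZero L]
    (hρ : Continuous (ρ : G → Matrix (Fin N) (Fin N) ℂ)) (β : ℝ) :
    Measurable fun U : GaugeConfig d L G =>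
      ENNReal.ofReal (Real.exp (-β * wilsonAction ρ U)) := by
  have h0 : Continuous fun t : ℝ => Real.exp (-β * t) := by fun_prop
  exact (h0.comp (continuous_wilsonAction ρ hρ)).measurable.ennreal_ofReal

/-- `0 < Z_Λ(β)`: the density is everywhere positive and the reference is a probability
measure. [folklore] -/
theorem partitionFunction_ne_zero {d L : ℕ} [NeZero L]
    (hρ : Continuous (ρ : G → Matrix (Fin N) (Fin N) ℂ)) (β : ℝ) :
    partitionFunction (d := d) (L := L) ρ β ≠ 0 := by
  unfold partitionFunction wilsonWeight
  rw [withDensity_apply _ MeasurableSet.univ, Measure.restrict_univ]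
  refine ne_of_gt ((lintegral_pos_iff_support (measurable_wilsonDensity ρ hρ β)).mpr ?_)
  have hsupp : Function.support (fun U : GaugeConfig d L G =>
      ENNReal.ofReal (Real.exp (-β * wilsonAction ρ U))) = Set.univ := by
    ext U
    simp only [Function.mem_support, ne_eq, ENNReal.ofReal_eq_zero, not_le, Set.mem_univ,
      iff_true]
    exact Real.exp_pos _
  rw [hsupp, measure_univ]
  exact one_pos

/-- **T2-AH GIBBS IDENTITY, PROVED**: `D(μ_{Λ,β} ‖ Haar^{⊗E}) = −β·⟨S⟩_β − log Z_Λ(β)` for the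
Wilson measure of any continuous `ρ` with `Re tr ρ ≤ N` on any compact second-countable `G`,
`β ≥ 0` (THEORY-2.md §3.2 v2.0 (a) in measure form; R-T2-10).  Proof: `μ = Z⁻¹·π.withDensity f`,
`dμ/dπ = Z⁻¹ f` a.e. (`Measure.rnDeriv_smul_left_of_ne_top'`, `Measure.rnDeriv_withDensity`),
`llr = log Z⁻¹ − β S` `μ`-a.e., `S` is bounded continuous hence integrable, and
`InformationTheory.toReal_klDiv`. [folklore] -/
theorem gibbsIdentity (d : ℕ) : GibbsIdentity d := by
  intro N G _ _ _ _ _ _ _ ρ hρ htr L _ β hβ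
  -- notation
  set π : Measure (GaugeConfig d L G) := Measure.pi fun _ : Edge d L => haarProbability G with hπ
  have hf := measurable_wilsonDensity (d := d) (L := L) ρ hρ β
  have hZtop : partitionFunction (d := d) (L := L) ρ β ≠ ⊤ :=
    ne_top_of_le_ne_top ENNReal.one_ne_top (partitionFunction_le_one ρ htr hβ)
  have hZ0 : partitionFunction (d := d) (L := L) ρ β ≠ 0 := partitionFunction_ne_zero ρ hρ β
  have hSc := continuous_wilsonAction (d := d) (L := L) ρ hρ
  -- the Wilson weight is finite and the Wilson measure is a probability measure
  haveI : IsFiniteMeasure (wilsonWeight (d := d) (L := L) ρ β) :=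
    ⟨lt_top_iff_ne_top.mpr hZtop⟩
  haveI hμ : IsProbabilityMeasure (wilsonMeasure (d := d) (L := L) ρ β) := ⟨by
    show ((partitionFunction ρ β)⁻¹ • wilsonWeight ρ β) Set.univ = 1
    rw [Measure.smul_apply, smul_eq_mul]
    exact ENNReal.inv_mul_cancel hZ0 hZtop⟩
  -- absolute continuity and the Radon–Nikodym derivative
  have hac : wilsonMeasure (d := d) (L := L) ρ β ≪ π :=
    Measure.smul_absolutelyContinuous.trans (withDensity_absolutelyContinuous π _)
  have h1 : (wilsonMeasure (d := d) (L := L) ρ β).rnDeriv π =ᵐ[π]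
      (partitionFunction (d := d) (L := L) ρ β)⁻¹ •
        (wilsonWeight (d := d) (L := L) ρ β).rnDeriv π :=
    Measure.rnDeriv_smul_left_of_ne_top' _ _ (ENNReal.inv_ne_top.mpr hZ0)
  have h2 : (wilsonWeight (d := d) (L := L) ρ β).rnDeriv π =ᵐ[π]
      fun U => ENNReal.ofReal (Real.exp (-β * wilsonAction ρ U)) :=
    Measure.rnDeriv_withDensity π hf
  have hzpos : 0 < ((partitionFunction (d := d) (L := L) ρ β)⁻¹).toReal :=
    ENNReal.toReal_pos (ENNReal.inv_ne_zero.mpr hZtop) (ENNReal.inv_ne_top.mpr hZ0)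
  -- the log-likelihood ratio, μ-a.e.
  have h_llr : llr (wilsonMeasure (d := d) (L := L) ρ β) π =ᵐ[wilsonMeasure (d := d) (L := L) ρ β]
      fun U => Real.log ((partitionFunction (d := d) (L := L) ρ β)⁻¹).toReal +
        (-β) * wilsonAction ρ U := by
    filter_upwards [hac.ae_eq h1, hac.ae_eq h2] with U h1U h2U
    rw [llr_def]
    beta_reduce
    rw [h1U, Pi.smul_apply, smul_eq_mul, h2U, ENNReal.toReal_mul,
      ENNReal.toReal_ofReal (Real.exp_nonneg _), Real.log_mul hzpos.ne' (Real.exp_pos _).ne',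
      Real.log_exp]
  -- integrability
  obtain ⟨C, hC⟩ := isCompact_univ.exists_bound_of_continuousOn (hSc.continuousOn (s := Set.univ))
  have hSint : Integrable (wilsonAction (d := d) (L := L) ρ)
      (wilsonMeasure (d := d) (L := L) ρ β) :=
    Integrable.of_bound hSc.aestronglyMeasurable C (ae_of_all _ fun U => hC U (Set.mem_univ U))
  have hg : Integrable (fun U => Real.log ((partitionFunction (d := d) (L := L) ρ β)⁻¹).toReal +
      (-β) * wilsonAction ρ U) (wilsonMeasure (d := d) (L := L) ρ β) :=
    (integrable_const _).add (hSint.const_mul _)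
  have hint : Integrable (llr (wilsonMeasure (d := d) (L := L) ρ β) π)
      (wilsonMeasure (d := d) (L := L) ρ β) := hg.congr h_llr.symm
  -- assemble
  rw [InformationTheory.toReal_klDiv hac hint, integral_congr_ae h_llr,
    integral_add (integrable_const _) (hSint.const_mul _), integral_const, integral_const_mul,
    probReal_univ, probReal_univ, one_smul, ENNReal.toReal_inv, Real.log_inv]
  unfold wilsonExpectation
  ring

end Gibbs

/-! ## Two free energies (T2-AH, measure form of `Theory2.klFin_tiltLaw_ge`):
`(β − β₁)·D(μ_{Λ,β} ‖ Haar^{⊗E}) ≥ β₁·log Z_Λ(β) − β·log Z_Λ(β₁)` -/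

section TwoFreeEnergies

variable {N : ℕ} {G : Type} [Group G] [TopologicalSpace G] [IsTopologicalGroup G]
  [CompactSpace G] [SecondCountableTopology G] [MeasurableSpace G] [BorelSpace G]
  (ρ : G →* Matrix (Fin N) (Fin N) ℂ)

/-- `Z_Λ(β)` as a Bochner integral of the (real) Wilson density. [folklore] -/
theorem toReal_partitionFunction_eq_integral {d L : ℕ} [NeZero L]
    (hρ : Continuous (ρ : G → Matrix (Fin N) (Fin N) ℂ)) (β : ℝ) :
    (partitionFunction (d := d) (L := L) ρ β).toReal =
      ∫ U, Real.exp (-β * wilsonAction ρ U)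
        ∂(Measure.pi fun _ : Edge d L => haarProbability G) := by
  have h0 : Continuous fun t : ℝ => Real.exp (-β * t) := by fun_prop
  unfold partitionFunction wilsonWeight
  rw [withDensity_apply _ MeasurableSet.univ, Measure.restrict_univ,
    integral_eq_lintegral_of_nonneg_ae (ae_of_all _ fun U => Real.exp_nonneg _)
      (h0.comp (continuous_wilsonAction (d := d) (L := L) ρ hρ)).aestronglyMeasurable]

/-- CONVEXITY SANDWICH in measure form (Jensen): `(β − β₁)·⟨S⟩_{Λ,β} ≤ log Z_Λ(β₁) − log Z_Λ(β)`
for `β, β₁ ≥ 0`, because `Z_Λ(β₁)/Z_Λ(β) = ⟨e^{(β−β₁)S}⟩_{Λ,β} ≥ e^{(β−β₁)⟨S⟩_{Λ,β}}`. [folklore] -/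
theorem mean_action_le_wilson {d L : ℕ} [NeZero L]
    (hρ : Continuous (ρ : G → Matrix (Fin N) (Fin N) ℂ)) (htr : ∀ g, (ρ g).trace.re ≤ N)
    (β β₁ : ℝ) (hβ : 0 ≤ β) (hβ₁ : 0 ≤ β₁) :
    (β - β₁) * wilsonExpectation (d := d) (L := L) ρ β (wilsonAction (d := d) (L := L) ρ) ≤
      Real.log (partitionFunction (d := d) (L := L) ρ β₁).toReal -
        Real.log (partitionFunction (d := d) (L := L) ρ β).toReal := by
  set π : Measure (GaugeConfig d L G) := Measure.pi fun _ : Edge d L => haarProbability G with hπ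
  have hf := measurable_wilsonDensity (d := d) (L := L) ρ hρ β
  have hZtop : partitionFunction (d := d) (L := L) ρ β ≠ ⊤ :=
    ne_top_of_le_ne_top ENNReal.one_ne_top (partitionFunction_le_one ρ htr hβ)
  have hZ0 : partitionFunction (d := d) (L := L) ρ β ≠ 0 := partitionFunction_ne_zero ρ hρ β
  have hZ₁top : partitionFunction (d := d) (L := L) ρ β₁ ≠ ⊤ :=
    ne_top_of_le_ne_top ENNReal.one_ne_top (partitionFunction_le_one ρ htr hβ₁)
  have hZ₁0 : partitionFunction (d := d) (L := L) ρ β₁ ≠ 0 := partitionFunction_ne_zero ρ hρ β₁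
  have hSc := continuous_wilsonAction (d := d) (L := L) ρ hρ
  haveI : IsFiniteMeasure (wilsonWeight (d := d) (L := L) ρ β) :=
    ⟨lt_top_iff_ne_top.mpr hZtop⟩
  haveI hμ : IsProbabilityMeasure (wilsonMeasure (d := d) (L := L) ρ β) := ⟨by
    show ((partitionFunction ρ β)⁻¹ • wilsonWeight ρ β) Set.univ = 1
    rw [Measure.smul_apply, smul_eq_mul]
    exact ENNReal.inv_mul_cancel hZ0 hZtop⟩
  have hzpos : 0 < (partitionFunction (d := d) (L := L) ρ β).toReal := ENNReal.toReal_pos hZ0 hZtop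
  have hz₁pos : 0 < (partitionFunction (d := d) (L := L) ρ β₁).toReal :=
    ENNReal.toReal_pos hZ₁0 hZ₁top
  -- integrability of the (bounded continuous) integrands
  obtain ⟨C, hC⟩ := isCompact_univ.exists_bound_of_continuousOn (hSc.continuousOn (s := Set.univ))
  have hF : Continuous fun U : GaugeConfig d L G => (β - β₁) * wilsonAction ρ U :=
    (by fun_prop : Continuous fun t : ℝ => (β - β₁) * t).comp hSc
  have hE : Continuous fun U : GaugeConfig d L G => Real.exp ((β - β₁) * wilsonAction ρ U) :=
    Real.continuous_exp.comp hF
  obtain ⟨C₁, hC₁⟩ := isCompact_univ.exists_bound_of_continuousOn (hF.continuousOn (s := Set.univ))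
  obtain ⟨C₂, hC₂⟩ := isCompact_univ.exists_bound_of_continuousOn (hE.continuousOn (s := Set.univ))
  have hFi : Integrable (fun U : GaugeConfig d L G => (β - β₁) * wilsonAction ρ U)
      (wilsonMeasure (d := d) (L := L) ρ β) :=
    Integrable.of_bound hF.aestronglyMeasurable C₁ (ae_of_all _ fun U => hC₁ U (Set.mem_univ U))
  have hEi : Integrable (fun U : GaugeConfig d L G => Real.exp ((β - β₁) * wilsonAction ρ U))
      (wilsonMeasure (d := d) (L := L) ρ β) :=
    Integrable.of_bound hE.aestronglyMeasurable C₂ (ae_of_all _ fun U => hC₂ U (Set.mem_univ U))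
  -- Jensen for `exp`
  have hJ : Real.exp (∫ U, (β - β₁) * wilsonAction ρ U ∂(wilsonMeasure (d := d) (L := L) ρ β)) ≤
      ∫ U, Real.exp ((β - β₁) * wilsonAction ρ U) ∂(wilsonMeasure (d := d) (L := L) ρ β) :=
    convexOn_exp.map_integral_le Real.continuous_exp.continuousOn isClosed_univ
      (ae_of_all _ fun U => Set.mem_univ _) hFi hEi
  -- `⟨e^{(β−β₁)S}⟩_β = Z(β₁)/Z(β)`
  have hI : ∫ U, Real.exp ((β - β₁) * wilsonAction ρ U) ∂(wilsonMeasure (d := d) (L := L) ρ β) =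
      ((partitionFunction (d := d) (L := L) ρ β)⁻¹).toReal *
        (partitionFunction (d := d) (L := L) ρ β₁).toReal := by
    show ∫ U, _ ∂((partitionFunction ρ β)⁻¹ • wilsonWeight ρ β) = _
    rw [integral_smul_measure, smul_eq_mul]
    congr 1
    show ∫ U, _ ∂(π.withDensity fun U => ENNReal.ofReal (Real.exp (-β * wilsonAction ρ U))) = _
    rw [integral_withDensity_eq_integral_toReal_smul hf
        (ae_of_all _ fun _ => ENNReal.ofReal_lt_top),
      toReal_partitionFunction_eq_integral ρ hρ β₁]
    refine integral_congr_ae (ae_of_all _ fun U => ?_)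
    simp only [smul_eq_mul]
    rw [ENNReal.toReal_ofReal (Real.exp_nonneg _), ← Real.exp_add]
    congr 1
    ring
  rw [integral_const_mul] at hJ
  rw [hI] at hJ
  have hlog := (Real.le_log_iff_exp_le (mul_pos (ENNReal.toReal_pos (ENNReal.inv_ne_zero.mpr hZtop)
    (ENNReal.inv_ne_top.mpr hZ0)) hz₁pos)).mpr hJ
  rw [Real.log_mul (ENNReal.toReal_pos (ENNReal.inv_ne_zero.mpr hZtop)
      (ENNReal.inv_ne_top.mpr hZ0)).ne' hz₁pos.ne', ENNReal.toReal_inv, Real.log_inv] at hlog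
  unfold wilsonExpectation
  linarith

/-- **T2-AH TWO FREE ENERGIES, measure form, PROVED**: for `0 ≤ β₁`, `0 ≤ β`,
`β₁·log Z_Λ(β) − β·log Z_Λ(β₁) ≤ (β − β₁)·D(μ_{Λ,β} ‖ Haar^{⊗E})` — the ENTROPY LOWER BOUND
from two values of the free energy (THEORY-2.md §3.2 v2.0 (iii); with `β₁ = β/2`:
`D ≥ log Z_Λ(β) − 2·log Z_Λ(β/2)`, which `peelingBound` (at `β/2`) and a small-ball bound (at `β`)
turn into the extensive `log β` growth of `EntropyGrowth`).  From `gibbsIdentity` and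
`mean_action_le_wilson`. [folklore] -/
theorem twoFreeEnergies_wilson {d L : ℕ} [NeZero L]
    (hρ : Continuous (ρ : G → Matrix (Fin N) (Fin N) ℂ)) (htr : ∀ g, (ρ g).trace.re ≤ N)
    (β β₁ : ℝ) (hβ : 0 ≤ β) (hβ₁ : 0 ≤ β₁) :
    β₁ * Real.log (partitionFunction (d := d) (L := L) ρ β).toReal -
        β * Real.log (partitionFunction (d := d) (L := L) ρ β₁).toReal ≤
      (β - β₁) * (InformationTheory.klDiv (wilsonMeasure (d := d) (L := L) ρ β)
        (Measure.pi fun _ : Edge d L => haarProbability G)).toReal := by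
  rw [gibbsIdentity d N G ρ hρ htr L β hβ]
  have h := mul_le_mul_of_nonneg_left
    (mean_action_le_wilson (d := d) (L := L) ρ hρ htr β β₁ hβ hβ₁) hβ
  linear_combination h

end TwoFreeEnergies

/-- **(T2-AH, two free energies — typed item, PROVED below.)**  For the Wilson theory of any
continuous `ρ` (`Re tr ρ ≤ N`) of any compact second-countable `G` on `(ℤ/L)^d` and all
`β, β₁ ≥ 0`: `β₁·log Z_Λ(β) − β·log Z_Λ(β₁) ≤ (β − β₁)·D(μ_{Λ,β} ‖ Haar^{⊗E})`.  With `β₁ = β/2`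
this is the entropy LOWER bound `D ≥ log Z_Λ(β) − 2 log Z_Λ(β/2)` that `peelingBound` (at `β/2`)
and a small-ball bound (at `β`) make extensive in `V·log β` (`EntropyGrowth`, lower half); with
`β₁ = 0` it is the trivial `D ≤ −log Z_Λ(β)`'s companion `0 ≤ D`.  Measure form of
`Theory2.klFin_tiltLaw_ge` (package `Scaling/FreeEnergyBudget.lean`). [folklore] -/
@[conjecture]
def TwoFreeEnergies (d : ℕ) : Prop :=
  ∀ (N : ℕ) (G : Type) [Group G] [TopologicalSpace G] [IsTopologicalGroup G] [CompactSpace G]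
    [SecondCountableTopology G] [MeasurableSpace G] [BorelSpace G]
    (ρ : G →* Matrix (Fin N) (Fin N) ℂ),
    Continuous (ρ : G → Matrix (Fin N) (Fin N) ℂ) → (∀ g, (ρ g).trace.re ≤ N) →
    ∀ (L : ℕ) [NeZero L] (β β₁ : ℝ), 0 ≤ β → 0 ≤ β₁ →
      β₁ * Real.log (partitionFunction (d := d) (L := L) ρ β).toReal -
          β * Real.log (partitionFunction (d := d) (L := L) ρ β₁).toReal ≤
        (β - β₁) * (InformationTheory.klDiv (wilsonMeasure (d := d) (L := L) ρ β)
          (Measure.pi fun _ : Edge d L => haarProbability G)).toReal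

/-- **T2-AH TWO FREE ENERGIES, PROVED** (`twoFreeEnergies_wilson`). [folklore] -/
theorem twoFreeEnergies (d : ℕ) : TwoFreeEnergies d :=
  fun _ G _ _ _ _ _ _ _ ρ hρ htr L _ β β₁ hβ hβ₁ =>
    twoFreeEnergies_wilson (d := d) (L := L) (G := G) ρ hρ htr β β₁ hβ hβ₁


end Summit.Ventures.LatticeQCDFlow.Theory2.Lattice
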